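import Literature.Probability.Percolation.IntPairCrossGeom
import Literature.Probability.Percolation.IntPairContract
import Literature.Probability.Percolation.IntExit
import Literature.Probability.Percolation.AdjExitTight
import HarnessLib

/-!
# Inner exits of clean routes: tip gaps, same-frame and cross-frame exits, tightness (twins of `AdjExitGaps`, `AdjExitOfRoute`, `AdjExitOfRouteCross`, `AdjExitTight`)

Topic `Literature/Probability/Percolation`; family `crit-perc` / near-critical percolation on `𝕋`.
A brick of the INNER half of the near-critical arm-separation theorem for four arms in the ADJACENT
colour arrangement (P. Nolin, EJP 13 (2008), Thm. 11, `j = 4`, `σ = BBWW` [arXiv 0711.4948: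
Thm. 10], §4.2 Def. 6–8, §4.4 Lemma 15, internal extremities). The clean routes of the inner pair
steps become `IntExit`s of the annulus region `intAnnRegion m N = {m ≤ |v| ≤ N}`:

* `int_tip_gap_above`, `int_tip_gap_below` — a protected tip and a tip of the other colour are
  `> 8k` rows apart (twins of `tip_gap_above/below`);
* `IntPairData.clean_route_region`, `IntPairData.exitOfRoute` (+ simp lemmas), `exit_protected`,
  `exitOfRoute_tight` (`IntExitTight`: the INTERIOR footprint, rows strictly between `z₁` and
  `z₁ + 3k`, columns of the square);
* `IntCrossData.symm_eq₁`, `symm_mem_region₁`, `swap_B𝔅`, `exitBelow₁`, `exitUp₁` (+ simp lemmas;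
  nominal tip `zUp z k` for fences from above), `B𝔅_norm_ge`, `symm_mem_fence_of_norm`,
  `exitBelow₁_tight`, `exitUp₁_tight`.

Everything here is proved; no named facts are introduced.

## References

* P. Nolin, Near-critical percolation in two dimensions, *Electron. J. Probab.* 13 (2008), §4.2
  Def. 6–8, §4.4 Lemma 15, internal extremities (arXiv 0711.4948: Def. 6–8, Lemma 14) [Nolin2008].
-/

noncomputable section

open Set

namespace Literature.Probability.Percolation

open LatticeModels HalfAnnulus
open IntPairData (term_isCrossing term_eq tip_isIntJ' term_open term_norm)

/-- **The annulus region of the inner arms.** [folklore] -/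
def intAnnRegion (m N : ℕ) : Set (Site 2) := {v | (m : ℤ) ≤ triNorm v ∧ triNorm v ≤ N}

/-- Membership in the annulus region, unfolded. [folklore] -/
@[simp] theorem mem_intAnnRegion {m N : ℕ} {v : Site 2} : v ∈ intAnnRegion m N ↔ (m : ℤ) ≤ triNorm v ∧ triNorm v ≤ N := Iff.rfl

/-! ### Tip gaps -/

/-- **A protected inner tip from below and a tip of the other colour above it are `> 8k` apart**
(`4 · 16k < m`). [cite: Nolin2008, §4.4 Lemma 15 (proof), internal extremities (arXiv 0711.4948: Lemma 14)] -/
theorem int_tip_gap_above {m k : ℕ} {c c' : Finset (Site 2)} {z z' : Site 2} {ω : SiteConfig (Site 2)}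
    (h : IntRawOK m c z k ω) (hk : 1 ≤ k) (hkm : 4 * (16 * k) < m) (hc : (intDom m).IsCrossing c z)
    (hcω : (↑c : Set (Site 2)) ⊆ ω) (hc' : (intDom m).IsCrossing c' z') (hc'ω : (↑c' : Set (Site 2)) ⊆ ωᶜ)
    (hlt : z 1 < z' 1) : z 1 + 8 * k < z' 1 := by
  by_contra hle
  rw [not_lt] at hle
  obtain ⟨hz0, hz1, hz1'⟩ := tip_isIntJ hc
  have hz'J := hc'.tip_mem_J
  obtain ⟨hz'0, -, -⟩ := (mem_intDom_J.1 hz'J).2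
  obtain ⟨f, hfc', hfF⟩ := hc'.exists_start
  have hfar := start_far_from_ends (R := 8 * k) (by omega) hfF (z 1) ⟨by omega, by omega⟩
  have hpath : PathIn triGraph (haSet m ∩ ωᶜ) z' f :=
    (hc'.conn z' hc'.tip_mem f hfc').mono fun v hv => ⟨by rw [← coe_haFin]; exact Finset.mem_coe.2 (hc'.subset hv), hc'ω hv⟩
  refine h.no_escape hk hc hcω (q := z') (t := f) (Finset.mem_union_right _ (JDomain.mem_Jabove.2 ⟨hz'J, by simpa using hlt⟩))
    ⟨by omega, by omega, by omega, hle⟩ ?_ hpath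
  push_cast at hfar ⊢; omega

/-- **A protected inner tip from above and a tip of the other colour below it are `> 8k` apart**
(`4 · 16k < m`). [cite: Nolin2008, §4.4 Lemma 15 (proof), internal extremities (arXiv 0711.4948: Lemma 14)] -/
theorem int_tip_gap_below {m k : ℕ} {d c' : Finset (Site 2)} {z z' : Site 2} {ω : SiteConfig (Site 2)}
    (h : IntRawOKUp m d z k ω) (hk : 1 ≤ k) (hkm : 4 * (16 * k) < m) (hd : (intDom m).flip.IsCrossing d z)
    (hdω : (↑d : Set (Site 2)) ⊆ ω) (hc' : (intDom m).IsCrossing c' z') (hc'ω : (↑c' : Set (Site 2)) ⊆ ωᶜ)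
    (hlt : z' 1 < z 1) : z' 1 + 8 * k < z 1 := by
  by_contra hle
  rw [not_lt] at hle
  have hd' : (intDom m).IsCrossing d z := (JDomain.flip_isCrossing_iff _).1 hd
  obtain ⟨hz0, hz1, hz1'⟩ := tip_isIntJ hd'
  have hz'J := hc'.tip_mem_J
  obtain ⟨hz'0, -, -⟩ := (mem_intDom_J.1 hz'J).2
  obtain ⟨f, hfc', hfF⟩ := hc'.exists_start
  have hfar := start_far_from_ends (R := 8 * k) (by omega) hfF (z 1) ⟨by omega, by omega⟩
  have hpath : PathIn triGraph (haSet m ∩ ωᶜ) z' f :=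
    (hc'.conn z' hc'.tip_mem f hfc').mono fun v hv => ⟨by rw [← coe_haFin]; exact Finset.mem_coe.2 (hc'.subset hv), hc'ω hv⟩
  refine h.no_escape_below hk hd hdω (q := z') (t := f) (Finset.mem_union_right _ (JDomain.mem_Jbelow.2 ⟨hz'J, by simpa using hlt⟩))
    ⟨by omega, by omega, by omega, by omega⟩ ?_ hpath
  push_cast at hfar ⊢; omega

/-! ### The tight interior footprint -/

/-- **The tight interior footprint** of an inner exit with nominal tip `z` and scale `k`: rows
strictly between `z₁` and `z₁ + 3k`, columns of the square of half-width `2k + 1` about `z`. [folklore] -/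
def IntExitTight (z : Site 2) (k : ℕ) (v : Site 2) : Prop :=
  z 1 < v 1 ∧ v 1 < z 1 + 3 * k ∧ z 0 - (2 * k + 1) ≤ v 0 ∧ v 0 ≤ z 0 + (2 * k + 1)

/-- The interior sites of an inner fence set from below are tight about its tip (`2 ≤ k`). [folklore] -/
theorem intExitTight_of_mem_intFenceSet {m k : ℕ} {c : Finset (Site 2)} {z v : Site 2} {ω : SiteConfig (Site 2)} {S : Set (Site 2)}
    (hk : 2 ≤ k) (hv : v ∈ intFenceSet m c z k ω S) (hn : triNorm v < m) : IntExitTight z k v := by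
  have h1 := mem_intFenceSet_beyond hv hn
  have hb := intFenceSet_box hv
  refine ⟨h1, ?_, hb.1, hb.2.1⟩
  have : (2 : ℤ) ≤ k := by exact_mod_cast hk
  linarith [hb.2.2.2]

/-- The interior sites of an inner fence set from above with tip `z⁺` are tight about the nominal
tip `zUp z⁺ k` (`2 ≤ k`). [folklore] -/
theorem intExitTight_of_mem_intFenceSetUp {m k : ℕ} {d : Finset (Site 2)} {z v : Site 2} {ω : SiteConfig (Site 2)} {S : Set (Site 2)}
    (hk : 2 ≤ k) (hv : v ∈ intFenceSetUp m d z k ω S) (hn : triNorm v < m) : IntExitTight (zUp z k) k v := by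
  have h1 := mem_intFenceSetUp_beyond hv hn
  have hb := intFenceSetUp_box hv
  have : (2 : ℤ) ≤ k := by exact_mod_cast hk
  refine ⟨?_, ?_, ?_, ?_⟩
  · rw [zUp_one]; linarith [hb.2.2.1]
  · rw [zUp_one]; linarith
  · rw [zUp_zero]; exact hb.1
  · rw [zUp_zero]; exact hb.2.1

/-- The nominal tip of a middle tip is on the inner tip arc when the tip is at least `3k + 2` rows
above the lower end. [folklore] -/
theorem zUp_isIntJ {m k : ℕ} {z : Site 2} (hz : IsIntJ m z) (hk : -(m : ℤ) + 2 + 3 * k ≤ z 1) : IsIntJ m (zUp z k) := by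
  obtain ⟨hz0, hz1, hz2⟩ := hz
  have hk0 : (0 : ℤ) ≤ k := by positivity
  refine ⟨by rw [zUp_zero]; exact hz0, by rw [zUp_one]; omega, by rw [zUp_one]; omega⟩

/-! ### Same-frame exits -/

namespace IntPairData

variable {m N k₀ K T R₀ : ℕ} {χ : SiteConfig (Site 2)}

/-- **A clean route lies in the annulus `{m ≤ |v| ≤ N}` or in the inner fence zone of its term, and
is open.** [folklore] -/
theorem clean_route_region (D : IntPairData m N k₀ K T R₀ χ) {u : ℕ} {c : Finset (Site 2)} {z : Site 2}
    (hu : (intDom m).lowestSeq χ u = some (c, z)) {S : Set (Site 2)} (hS : S ⊆ D.Bset ∪ (D.fence hu).F) :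
    S ⊆ (intAnnRegion m N ∪ intFrameZone m z (D.kOf hu)) ∩ χ := fun v hv => by
  refine ⟨?_, D.Aset_subset (D.clean_route_subset_Aset hu hS hv)⟩
  rcases hS hv with (⟨i', hv'⟩ | ⟨u', c', z', hu', h⟩) | h
  · exact Or.inl (D.supp i' v hv').1
  · have hN : 4 * (m : ℤ) ≤ N := by exact_mod_cast D.hN
    have ht := term_norm hu' (Finset.mem_coe.1 h)
    exact Or.inl ⟨ht.1, by omega⟩
  · exact Or.inr ((D.fence hu).F_subset h).1.1.1

/-- **The fenced inner exit of a clean route.** [cite: Nolin2008, §4.2 Def. 6–8 and §4.4, internal extremities (arXiv 0711.4948: Def. 6–8, Lemma 14)] -/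
def exitOfRoute (D : IntPairData m N k₀ K T R₀ χ) (i : Fin 2) {u : ℕ} {c : Finset (Site 2)} {z : Site 2}
    (hu : (intDom m).lowestSeq χ u = some (c, z)) {S : Set (Site 2)} (hP : PathIn triGraph S (D.b i) (D.fence hu).m')
    (hS : S ⊆ D.Bset ∪ (D.fence hu).F) : IntFencedExit m (intAnnRegion m N) k₀ K χ where
  z := z
  j := D.jOf hu
  m' := (D.fence hu).m'
  b := D.b i
  z_isIntJ := tip_isIntJ' hu
  j_lt := (D.jOf_spec hu).1
  b_far := D.b_far i
  vcross := (D.fence hu).vcross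
  path := hP.mono (D.clean_route_region hu hS)

/-- The tip of the exit of a clean route. [folklore] -/
@[simp] theorem exitOfRoute_z (D : IntPairData m N k₀ K T R₀ χ) (i : Fin 2) {u : ℕ} {c : Finset (Site 2)} {z : Site 2}
    (hu : (intDom m).lowestSeq χ u = some (c, z)) {S : Set (Site 2)} (hP : PathIn triGraph S (D.b i) (D.fence hu).m')
    (hS : S ⊆ D.Bset ∪ (D.fence hu).F) : (D.exitOfRoute i hu hP hS).z = z := rfl

/-- The fence site of the exit of a clean route. [folklore] -/
@[simp] theorem exitOfRoute_m' (D : IntPairData m N k₀ K T R₀ χ) (i : Fin 2) {u : ℕ} {c : Finset (Site 2)} {z : Site 2}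
    (hu : (intDom m).lowestSeq χ u = some (c, z)) {S : Set (Site 2)} (hP : PathIn triGraph S (D.b i) (D.fence hu).m')
    (hS : S ⊆ D.Bset ∪ (D.fence hu).F) : (D.exitOfRoute i hu hP hS).m' = (D.fence hu).m' := rfl

/-- The far end of the exit of a clean route. [folklore] -/
@[simp] theorem exitOfRoute_b (D : IntPairData m N k₀ K T R₀ χ) (i : Fin 2) {u : ℕ} {c : Finset (Site 2)} {z : Site 2}
    (hu : (intDom m).lowestSeq χ u = some (c, z)) {S : Set (Site 2)} (hP : PathIn triGraph S (D.b i) (D.fence hu).m')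
    (hS : S ⊆ D.Bset ∪ (D.fence hu).F) : (D.exitOfRoute i hu hP hS).b = D.b i := rfl

/-- The scale of the exit of a clean route is the scale of the term. [folklore] -/
@[simp] theorem exitOfRoute_k (D : IntPairData m N k₀ K T R₀ χ) (i : Fin 2) {u : ℕ} {c : Finset (Site 2)} {z : Site 2}
    (hu : (intDom m).lowestSeq χ u = some (c, z)) {S : Set (Site 2)} (hP : PathIn triGraph S (D.b i) (D.fence hu).m')
    (hS : S ⊆ D.Bset ∪ (D.fence hu).F) : (D.exitOfRoute i hu hP hS).k = D.kOf hu := rfl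

/-- **The protection of the exit**: the fenced, protected inner tip. [cite: Nolin2008, §4.4 Lemma 15 (proof), internal extremities (arXiv 0711.4948: Lemma 14)] -/
theorem exit_protected (D : IntPairData m N k₀ K T R₀ χ) {u : ℕ} {c : Finset (Site 2)} {z : Site 2}
    (hu : (intDom m).lowestSeq χ u = some (c, z)) : IntTipOK m z (D.kOf hu) χ (D.fence hu).m' :=
  ⟨(D.fence hu).vcross, fun _ _ hq hqin ht =>
    (D.raw hu).no_escape (D.one_le_kOf hu) (term_isCrossing hu) (term_open hu) hq hqin ht⟩

/-- **The route of `exitOfRoute` is tight inside `Λ_m`.** [folklore] -/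
theorem exitOfRoute_tight (D : IntPairData m N k₀ K T R₀ χ) (i : Fin 2) {u : ℕ} {c : Finset (Site 2)} {z : Site 2}
    (hu : (intDom m).lowestSeq χ u = some (c, z)) {S : Set (Site 2)} (hP : PathIn triGraph S (D.b i) (D.fence hu).m')
    (hS : S ⊆ D.Bset ∪ (D.fence hu).F) :
    ∀ v ∈ S, triNorm v < m → IntExitTight (D.exitOfRoute i hu hP hS).z (D.exitOfRoute i hu hP hS).k v := by
  intro v hv hn
  have hvF := D.clean_route_interior hu hS hv hn
  rw [exitOfRoute_z, exitOfRoute_k]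
  exact intExitTight_of_mem_intFenceSet (D.two_le_kOf hu) ((D.fence hu).F_subset hvF) hn

end IntPairData

/-! ### Cross-frame exits -/

namespace IntCrossData

variable {m N k₀ K T₁ T₁' T₂ T₂' R₀ i₁ i₂ : ℕ} {ω : SiteConfig (Site 2)}
  (X : IntCrossData m N k₀ K T₁ T₁' T₂ T₂' R₀ (rotConfig i₁ ω) (rotConfig i₂ ω))

/-- The inverse frame map of `D₁` is the inverse rotation. [folklore] -/
theorem symm_eq₁ (X : IntCrossData m N k₀ K T₁ T₁' T₂ T₂' R₀ (rotConfig i₁ ω) (rotConfig i₂ ω)) (hφ₁ : ∀ u, X.φ₁ u = triRotIsoPow i₁ u) (y : Site 2) : X.φ₁.symm y = (triRotIsoPow i₁).symm y := by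
  rw [RelIso.symm_apply_eq, hφ₁, RelIso.apply_symm_apply]

/-- **A non-fence site read in the frame of `D₁` lies in the annulus and is open in `rotConfig i₁ ω`.** [folklore] -/
theorem symm_mem_region₁ (hi₁ : i₁ < 6) (hφ₁ : ∀ u, X.φ₁ u = triRotIsoPow i₁ u) (hφ₂ : ∀ u, X.φ₂ u = triRotIsoPow i₂ u)
    {w : Site 2} (hw : w ∈ X.B𝔅) : X.φ₁.symm w ∈ intAnnRegion m N ∩ (rotConfig i₁ ω : Set (Site 2)) := by
  have hN₁ : 4 * (m : ℤ) ≤ N := by exact_mod_cast X.D₁.hN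
  have hopen : w ∈ ω := by
    rcases hw.1 with ⟨x, hx, rfl⟩ | ⟨x, hx, rfl⟩
    · have h := X.D₁.AsetB_subset hx
      rw [mem_rotConfig] at h; rwa [hφ₁]
    · have h := X.D₂.AsetB_subset hx
      rw [mem_rotConfig] at h; rwa [hφ₂]
  refine ⟨?_, ?_⟩
  · rcases X.mem_B𝔅 hw with ⟨x, hx, hxw⟩ | ⟨x, hx, hxw⟩
    · have hv : X.φ₁.symm w = x := by rw [← hxw, RelIso.symm_apply_apply]
      rw [hv]
      rcases hx with hx | ⟨u, c, z, hu, hx⟩ | ⟨u, d, z, hu, hx⟩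
      · obtain ⟨i, hi⟩ := hx; exact (X.D₁.supp i x hi).1
      · have h := mem_haFin.1 ((term_isCrossing hu).subset hx); exact ⟨h.2.1, by omega⟩
      · have h := mem_haFin.1 ((IntPairDataB.termUp_isCrossing hu).subset hx); exact ⟨h.2.1, by omega⟩
    · have hv : X.φ₁.symm w = triRotIsoPow ((i₂ + (6 - i₁)) % 6) x := by
        rw [← hxw, hφ₂, X.symm_eq₁ hφ₁, triRotIsoPow_symm_comp_apply hi₁.le]
      rw [hv, mem_intAnnRegion, triNorm_triRotIsoPow, ← mem_intAnnRegion]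
      rcases hx with hx | ⟨u, c, z, hu, hx⟩ | ⟨u, d, z, hu, hx⟩
      · obtain ⟨i, hi⟩ := hx; exact (X.D₂.supp i x hi).1
      · have h := mem_haFin.1 ((term_isCrossing hu).subset hx); exact ⟨h.2.1, by omega⟩
      · have h := mem_haFin.1 ((IntPairDataB.termUp_isCrossing hu).subset hx); exact ⟨h.2.1, by omega⟩
  · show X.φ₁.symm w ∈ rotConfig i₁ ω
    rw [mem_rotConfig, ← hφ₁, RelIso.apply_symm_apply]
    exact hopen

/-- The non-fence sites of the swapped data are the same. [folklore] -/
theorem swap_B𝔅 {χ₁ χ₂ : SiteConfig (Site 2)} (Y : IntCrossData m N k₀ K T₁ T₁' T₂ T₂' R₀ χ₁ χ₂) : Y.swap.B𝔅 = Y.B𝔅 := by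
  ext v
  simp only [B𝔅, Aset𝔄, FF𝔉, Set.mem_sdiff, Set.mem_union]
  constructor
  · rintro ⟨h1, h2⟩; exact ⟨h1.symm, fun h => h2 h.symm⟩
  · rintro ⟨h1, h2⟩; exact ⟨h1.symm, fun h => h2 h.symm⟩

/-- **The inner exit through a fence from below of `D₁`** reached by a clean route from the far end
`b i` of `D₁`, read in the frame of `D₁`. [cite: Nolin2008, §4.2 Def. 6–8 and §4.4, internal extremities (arXiv 0711.4948: Def. 6–8, Lemma 14)] -/
def exitBelow₁ (hi₁ : i₁ < 6) (hφ₁ : ∀ u, X.φ₁ u = triRotIsoPow i₁ u) (hφ₂ : ∀ u, X.φ₂ u = triRotIsoPow i₂ u)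
    {u : ℕ} {c : Finset (Site 2)} {z : Site 2} (hu : (intDom m).lowestSeq (rotConfig i₁ ω) u = some (c, z)) (i : Fin 2)
    {S : Set (Site 2)} (hP : PathIn triGraph S (X.φ₁ (X.D₁.b i)) (X.φ₁ (X.D₁.fence hu).m'))
    (hS : S ⊆ X.B𝔅 ∪ X.φ₁ '' (X.D₁.fence hu).F) : IntExit m (intAnnRegion m N) k₀ K (rotConfig i₁ ω) where
  z := z
  j := X.D₁.jOf hu
  m' := (X.D₁.fence hu).m'
  b := X.D₁.b i
  z_isIntJ := tip_isIntJ' hu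
  j_lt := (X.D₁.jOf_spec hu).1
  b_far := X.D₁.b_far i
  vcross := (X.D₁.fence hu).vcross
  path := by
    have h := pathIn_map_iso X.φ₁.symm hP
    rw [RelIso.symm_apply_apply, RelIso.symm_apply_apply] at h
    refine h.mono ?_
    rintro v ⟨w, hw, rfl⟩
    rcases hS hw with hw | ⟨y, hy, hyw⟩
    · have hr := X.symm_mem_region₁ hi₁ hφ₁ hφ₂ hw
      exact ⟨Or.inl hr.1, hr.2⟩
    · rw [← hyw, RelIso.symm_apply_apply]
      have hF := (X.D₁.fence hu).F_subset hy
      exact ⟨Or.inr (intFrameZone_subset_intExitZone hF.1.1.1), intFenceSet_subset hF⟩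

/-- The tip of `exitBelow₁`. [folklore] -/
@[simp] theorem exitBelow₁_z (hi₁ : i₁ < 6) (hφ₁ : ∀ u, X.φ₁ u = triRotIsoPow i₁ u) (hφ₂ : ∀ u, X.φ₂ u = triRotIsoPow i₂ u)
    {u : ℕ} {c : Finset (Site 2)} {z : Site 2} (hu : (intDom m).lowestSeq (rotConfig i₁ ω) u = some (c, z)) (i : Fin 2)
    {S : Set (Site 2)} (hP : PathIn triGraph S (X.φ₁ (X.D₁.b i)) (X.φ₁ (X.D₁.fence hu).m'))
    (hS : S ⊆ X.B𝔅 ∪ X.φ₁ '' (X.D₁.fence hu).F) : (X.exitBelow₁ hi₁ hφ₁ hφ₂ hu i hP hS).z = z := rfl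

/-- The scale of `exitBelow₁`. [folklore] -/
@[simp] theorem exitBelow₁_k (hi₁ : i₁ < 6) (hφ₁ : ∀ u, X.φ₁ u = triRotIsoPow i₁ u) (hφ₂ : ∀ u, X.φ₂ u = triRotIsoPow i₂ u)
    {u : ℕ} {c : Finset (Site 2)} {z : Site 2} (hu : (intDom m).lowestSeq (rotConfig i₁ ω) u = some (c, z)) (i : Fin 2)
    {S : Set (Site 2)} (hP : PathIn triGraph S (X.φ₁ (X.D₁.b i)) (X.φ₁ (X.D₁.fence hu).m'))
    (hS : S ⊆ X.B𝔅 ∪ X.φ₁ '' (X.D₁.fence hu).F) : (X.exitBelow₁ hi₁ hφ₁ hφ₂ hu i hP hS).k = X.D₁.kOf hu := rfl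

/-- The far end of `exitBelow₁`. [folklore] -/
@[simp] theorem exitBelow₁_b (hi₁ : i₁ < 6) (hφ₁ : ∀ u, X.φ₁ u = triRotIsoPow i₁ u) (hφ₂ : ∀ u, X.φ₂ u = triRotIsoPow i₂ u)
    {u : ℕ} {c : Finset (Site 2)} {z : Site 2} (hu : (intDom m).lowestSeq (rotConfig i₁ ω) u = some (c, z)) (i : Fin 2)
    {S : Set (Site 2)} (hP : PathIn triGraph S (X.φ₁ (X.D₁.b i)) (X.φ₁ (X.D₁.fence hu).m'))
    (hS : S ⊆ X.B𝔅 ∪ X.φ₁ '' (X.D₁.fence hu).F) : (X.exitBelow₁ hi₁ hφ₁ hφ₂ hu i hP hS).b = X.D₁.b i := rfl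

/-- The fence site of `exitBelow₁`. [folklore] -/
@[simp] theorem exitBelow₁_m' (hi₁ : i₁ < 6) (hφ₁ : ∀ u, X.φ₁ u = triRotIsoPow i₁ u) (hφ₂ : ∀ u, X.φ₂ u = triRotIsoPow i₂ u)
    {u : ℕ} {c : Finset (Site 2)} {z : Site 2} (hu : (intDom m).lowestSeq (rotConfig i₁ ω) u = some (c, z)) (i : Fin 2)
    {S : Set (Site 2)} (hP : PathIn triGraph S (X.φ₁ (X.D₁.b i)) (X.φ₁ (X.D₁.fence hu).m'))
    (hS : S ⊆ X.B𝔅 ∪ X.φ₁ '' (X.D₁.fence hu).F) : (X.exitBelow₁ hi₁ hφ₁ hφ₂ hu i hP hS).m' = (X.D₁.fence hu).m' := rfl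

/-- **The inner exit through a fence from above of `D₁`** reached by a clean route from the far end
`b i` of `D₁`: NOMINAL tip `zUp z kOfUp`, the corner crossing of the fence (below the tip `z`), and
the route read in the frame of `D₁`. [cite: Nolin2008, §4.2 Def. 6–8 and §4.4, internal extremities (arXiv 0711.4948: Def. 6–8, Lemma 14)] -/
def exitUp₁ (hi₁ : i₁ < 6) (hφ₁ : ∀ u, X.φ₁ u = triRotIsoPow i₁ u) (hφ₂ : ∀ u, X.φ₂ u = triRotIsoPow i₂ u)
    {u : ℕ} {d : Finset (Site 2)} {z : Site 2} (hu : (intDom m).flip.lowestSeq (rotConfig i₁ ω) u = some (d, z)) (i : Fin 2)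
    {S : Set (Site 2)} (hP : PathIn triGraph S (X.φ₁ (X.D₁.b i)) (X.φ₁ (X.D₁.fenceUp hu).m'))
    (hS : S ⊆ X.B𝔅 ∪ X.φ₁ '' (X.D₁.fenceUp hu).F) : IntExit m (intAnnRegion m N) k₀ K (rotConfig i₁ ω) where
  z := zUp z (X.D₁.kOfUp hu)
  j := X.D₁.jOfUp hu
  m' := (X.D₁.fenceUp hu).m'
  b := X.D₁.b i
  z_isIntJ := by
    have hmid := X.D₁.tipUp_mid hu
    have hk := X.D₁.one_le_kOfUp hu
    exact zUp_isIntJ (IntPairDataB.tipUp_isIntJ hu) (by unfold IntPairDataB.kOfUp at hmid hk ⊢; omega)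
  j_lt := (X.D₁.jOfUp_spec hu).1
  b_far := X.D₁.b_far i
  vcross := by
    have h := (X.D₁.fenceUp hu).vcross
    simp only [zUp_zero, zUp_one, IntPairDataB.kOfUp] at h ⊢
    convert h using 3 <;> ring
  path := by
    have h := pathIn_map_iso X.φ₁.symm hP
    rw [RelIso.symm_apply_apply, RelIso.symm_apply_apply] at h
    refine h.mono ?_
    rintro v ⟨w, hw, rfl⟩
    rcases hS hw with hw | ⟨y, hy, hyw⟩
    · have hr := X.symm_mem_region₁ hi₁ hφ₁ hφ₂ hw
      exact ⟨Or.inl hr.1, hr.2⟩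
    · rw [← hyw, RelIso.symm_apply_apply]
      have hF := (X.D₁.fenceUp hu).F_subset hy
      exact ⟨Or.inr (intFrameZoneBelow_subset_intExitZone (k := X.D₁.kOfUp hu) (z := zUp z (X.D₁.kOfUp hu)) (z' := z)
          (zUp_zero _ _).symm (by rw [zUp_one]; ring) hF.1.1.1),
        intFenceSetUp_subset hF⟩

/-- The nominal tip of `exitUp₁`. [folklore] -/
@[simp] theorem exitUp₁_z (hi₁ : i₁ < 6) (hφ₁ : ∀ u, X.φ₁ u = triRotIsoPow i₁ u) (hφ₂ : ∀ u, X.φ₂ u = triRotIsoPow i₂ u)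
    {u : ℕ} {d : Finset (Site 2)} {z : Site 2} (hu : (intDom m).flip.lowestSeq (rotConfig i₁ ω) u = some (d, z)) (i : Fin 2)
    {S : Set (Site 2)} (hP : PathIn triGraph S (X.φ₁ (X.D₁.b i)) (X.φ₁ (X.D₁.fenceUp hu).m'))
    (hS : S ⊆ X.B𝔅 ∪ X.φ₁ '' (X.D₁.fenceUp hu).F) : (X.exitUp₁ hi₁ hφ₁ hφ₂ hu i hP hS).z = zUp z (X.D₁.kOfUp hu) := rfl

/-- The scale of `exitUp₁`. [folklore] -/
@[simp] theorem exitUp₁_k (hi₁ : i₁ < 6) (hφ₁ : ∀ u, X.φ₁ u = triRotIsoPow i₁ u) (hφ₂ : ∀ u, X.φ₂ u = triRotIsoPow i₂ u)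
    {u : ℕ} {d : Finset (Site 2)} {z : Site 2} (hu : (intDom m).flip.lowestSeq (rotConfig i₁ ω) u = some (d, z)) (i : Fin 2)
    {S : Set (Site 2)} (hP : PathIn triGraph S (X.φ₁ (X.D₁.b i)) (X.φ₁ (X.D₁.fenceUp hu).m'))
    (hS : S ⊆ X.B𝔅 ∪ X.φ₁ '' (X.D₁.fenceUp hu).F) : (X.exitUp₁ hi₁ hφ₁ hφ₂ hu i hP hS).k = X.D₁.kOfUp hu := rfl

/-- The far end of `exitUp₁`. [folklore] -/
@[simp] theorem exitUp₁_b (hi₁ : i₁ < 6) (hφ₁ : ∀ u, X.φ₁ u = triRotIsoPow i₁ u) (hφ₂ : ∀ u, X.φ₂ u = triRotIsoPow i₂ u)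
    {u : ℕ} {d : Finset (Site 2)} {z : Site 2} (hu : (intDom m).flip.lowestSeq (rotConfig i₁ ω) u = some (d, z)) (i : Fin 2)
    {S : Set (Site 2)} (hP : PathIn triGraph S (X.φ₁ (X.D₁.b i)) (X.φ₁ (X.D₁.fenceUp hu).m'))
    (hS : S ⊆ X.B𝔅 ∪ X.φ₁ '' (X.D₁.fenceUp hu).F) : (X.exitUp₁ hi₁ hφ₁ hφ₂ hu i hP hS).b = X.D₁.b i := rfl

/-- The fence site of `exitUp₁`. [folklore] -/
@[simp] theorem exitUp₁_m' (hi₁ : i₁ < 6) (hφ₁ : ∀ u, X.φ₁ u = triRotIsoPow i₁ u) (hφ₂ : ∀ u, X.φ₂ u = triRotIsoPow i₂ u)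
    {u : ℕ} {d : Finset (Site 2)} {z : Site 2} (hu : (intDom m).flip.lowestSeq (rotConfig i₁ ω) u = some (d, z)) (i : Fin 2)
    {S : Set (Site 2)} (hP : PathIn triGraph S (X.φ₁ (X.D₁.b i)) (X.φ₁ (X.D₁.fenceUp hu).m'))
    (hS : S ⊆ X.B𝔅 ∪ X.φ₁ '' (X.D₁.fenceUp hu).F) : (X.exitUp₁ hi₁ hφ₁ hφ₂ hu i hP hS).m' = (X.D₁.fenceUp hu).m' := rfl

/-- Non-fence admissible sites have norm `≥ m` (rotations preserve the norm). [folklore] -/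
theorem B𝔅_norm_ge (hφ₁ : ∀ u, X.φ₁ u = triRotIsoPow i₁ u) (hφ₂ : ∀ u, X.φ₂ u = triRotIsoPow i₂ u)
    {w : Site 2} (hw : w ∈ X.B𝔅) : (m : ℤ) ≤ triNorm w := by
  rcases X.mem_B𝔅 hw with ⟨x, hx, hxw⟩ | ⟨x, hx, hxw⟩
  · rw [← hxw, hφ₁, triNorm_triRotIsoPow]
    rcases hx with hx | ⟨u, c, z, hu, hx⟩ | ⟨u, d, z, hu, hx⟩
    · exact X.D₁.armSet_norm_ge hx
    · exact (term_norm hu hx).1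
    · exact (mem_haFin.1 ((IntPairDataB.termUp_isCrossing hu).subset hx)).2.1
  · rw [← hxw, hφ₂, triNorm_triRotIsoPow]
    rcases hx with hx | ⟨u, c, z, hu, hx⟩ | ⟨u, d, z, hu, hx⟩
    · exact X.D₂.armSet_norm_ge hx
    · exact (term_norm hu hx).1
    · exact (mem_haFin.1 ((IntPairDataB.termUp_isCrossing hu).subset hx)).2.1

/-- A site of a clean route read in the frame of `D₁` and inside `Λ_m` is a site of the fence. [folklore] -/
theorem symm_mem_fence_of_norm (hφ₁ : ∀ u, X.φ₁ u = triRotIsoPow i₁ u) (hφ₂ : ∀ u, X.φ₂ u = triRotIsoPow i₂ u)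
    {F S : Set (Site 2)} (hS : S ⊆ X.B𝔅 ∪ X.φ₁ '' F) {v : Site 2} (hv : v ∈ X.φ₁.symm '' S) (hn : triNorm v < m) : v ∈ F := by
  obtain ⟨w, hw, rfl⟩ := hv
  rcases hS hw with hw' | ⟨y, hy, hyw⟩
  · exfalso
    have h := X.B𝔅_norm_ge hφ₁ hφ₂ hw'
    rw [X.symm_eq₁ hφ₁, ← triNorm_triRotIsoPow i₁ ((triRotIsoPow i₁).symm w), RelIso.apply_symm_apply] at hn
    exact absurd h (not_le.2 hn)
  · rw [← hyw, RelIso.symm_apply_apply]; exact hy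

/-- **The route of `exitBelow₁` is tight inside `Λ_m`.** [folklore] -/
theorem exitBelow₁_tight (hi₁ : i₁ < 6) (hφ₁ : ∀ u, X.φ₁ u = triRotIsoPow i₁ u) (hφ₂ : ∀ u, X.φ₂ u = triRotIsoPow i₂ u)
    {u : ℕ} {c : Finset (Site 2)} {z : Site 2} (hu : (intDom m).lowestSeq (rotConfig i₁ ω) u = some (c, z)) (i : Fin 2)
    {S : Set (Site 2)} (hP : PathIn triGraph S (X.φ₁ (X.D₁.b i)) (X.φ₁ (X.D₁.fence hu).m'))
    (hS : S ⊆ X.B𝔅 ∪ X.φ₁ '' (X.D₁.fence hu).F) :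
    ∀ v ∈ X.φ₁.symm '' S, triNorm v < m →
      IntExitTight (X.exitBelow₁ hi₁ hφ₁ hφ₂ hu i hP hS).z (X.exitBelow₁ hi₁ hφ₁ hφ₂ hu i hP hS).k v := by
  intro v hv hn
  have hvF := X.symm_mem_fence_of_norm hφ₁ hφ₂ hS hv hn
  rw [exitBelow₁_z, exitBelow₁_k]
  exact intExitTight_of_mem_intFenceSet (X.D₁.two_le_kOf hu) ((X.D₁.fence hu).F_subset hvF) hn

/-- **The route of `exitUp₁` is tight inside `Λ_m`** (about the nominal tip). [folklore] -/
theorem exitUp₁_tight (hi₁ : i₁ < 6) (hφ₁ : ∀ u, X.φ₁ u = triRotIsoPow i₁ u) (hφ₂ : ∀ u, X.φ₂ u = triRotIsoPow i₂ u)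
    {u : ℕ} {d : Finset (Site 2)} {z : Site 2} (hu : (intDom m).flip.lowestSeq (rotConfig i₁ ω) u = some (d, z)) (i : Fin 2)
    {S : Set (Site 2)} (hP : PathIn triGraph S (X.φ₁ (X.D₁.b i)) (X.φ₁ (X.D₁.fenceUp hu).m'))
    (hS : S ⊆ X.B𝔅 ∪ X.φ₁ '' (X.D₁.fenceUp hu).F) :
    ∀ v ∈ X.φ₁.symm '' S, triNorm v < m →
      IntExitTight (X.exitUp₁ hi₁ hφ₁ hφ₂ hu i hP hS).z (X.exitUp₁ hi₁ hφ₁ hφ₂ hu i hP hS).k v := by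
  intro v hv hn
  have hvF := X.symm_mem_fence_of_norm hφ₁ hφ₂ hS hv hn
  rw [exitUp₁_z, exitUp₁_k]
  exact intExitTight_of_mem_intFenceSetUp (X.D₁.two_le_kOfUp hu) ((X.D₁.fenceUp hu).F_subset hvF) hn

end IntCrossData

end Literature.Probability.Percolation
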